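import Summits.QuantumFields.BalabanUV.Beta.MultiscaleCombesThomasBudget
import Summits.QuantumFields.BalabanUV.Beta.CoarseCoerciveCovariantLaplacian

/-!
# `Summit.QuantumFields.BalabanUV.Beta.MultiscaleCombesThomasCovariant` — the SITEWISE conjugation defect of a COVARIANT
# LAPLACIAN `D_Wᴴ D_W` (fibred lattice `S × Cp`, real transporters `W_b`), EXACT and FIBRE-DIMENSION-FREE:
# `Re conjForm (D_WᴴD_W) κ φ z = ‖D_W z‖² − Σ_b 2(cosh κ(φ_{tgt b} − φ_{src b}) − 1)·Re⟨W_b z_{tgt b}, z_{src b}⟩`, hence for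
# isometric `W` the covariant Laplacian costs, AT EACH SITE `x`, only `Σ_{b ∋ x}(cosh κΔφ_b − 1)` — second order in the weight
# step across the bonds AT `x`, no `|Cp|` factor, no `sup` over sites; with the mass term free, `covLap μ W` + a positive part
# with a sitewise budget inherit the scale-adapted END of `MultiscaleCombesThomasBudget` (file 3 of the engine; v1.0.1)

HONEST FRAMING (page 1 of everything in this cell).  Discharging `FlowStep.BetaPertH` would make Bałaban's
ultraviolet stability UNCONDITIONAL — a constructive-QFT result; it is NOT the continuum limit and NOT the Clay
problem.  This module discharges nothing of `BetaPertH`; it is ELEMENTARY finite-dimensional linear algebra ([folklore]: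
the Combes–Thomas ∕ Agmon conjugation of a Gram operator, computed bond by bond), kernel-checked, written by the OWNER of
binder row D4 (unit `b2b-balaban-beta-an4`, gen 42; claim «MULTISCALE-CT-LOCAL», journal l.17755) for NODE O.2 item (v)
«k-UNIFORM constants», DECAY half — in the currency of the lineage's E-I3 chain (`CoarseCoerciveCovariantEnergy.covDiff`,
`CoarseCoerciveCovariantLaplacian.covLap`).  HONEST DEPENDENCY: continuum YM on T⁴ ⇐ BetaPertH ∧ nine spine estimates
(0/9 proved); BetaPertH ⇐ (D1) ∧ (D4) ∧ CAP+tail; G-an2-4 gates asym, D1 and NE2/3/4.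

WHY THIS FILE.  Files 1–2 (`MultiscaleCombesThomas`, `…Budget`, p228128 ∕ p228368) turn a SITEWISE conjugation budget
`J_e` against a local coercivity profile `λ_e` into the local-prefactor decay `‖A⁻¹(i,j)‖ ≤ 2e^{−κd(i,j)}/√(λ_iλ_j)`; the
generic sitewise budget there (`localLower_of_isHermitian`, row mass `Σ_{e′}‖H(e,e′)‖` in COMPONENT indexing) would charge a
covariant Laplacian on `S × Cp` the entry sums `Σ_{i′}|W_b(i,i′)|` — a fibre-dimension factor.  Here the defect is computed
through the Gram structure instead: per bond, in fibre `ℓ²`, with the transporter entering only through `‖W_b v‖ = ‖v‖`.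
This is the matrix-currency template of the «sitewise `dPart_ge`» named as the MODEL-side residual of the decay half in the
owner's XREAD C-an4-129 (INFO-2); pv21's `B9Thm37GlueTorusCovCT.dPart_ge` is its global-constant real twin.

CONTENT (all [folklore]; hypothesis SHAPES written out, no `Prop`-valued definitions).
* §1 `conjForm_eq_pair`: `conjForm A κ ρ z = ⟨e^{κρ}z, A(e^{−κρ}z)⟩`; for a Gram kernel `conjForm (DᴴD) κ ρ z =
  ⟨D(e^{κρ}z), D(e^{−κρ}z)⟩` (`conjForm_gram`) — any rectangular `D`.
* §2 THE COVARIANT LAPLACIAN, bond by bond: `slice_covDiff_wt` (the weighted slices), the per-bond identity and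
  **`re_conjForm_covGram`**: `Re conjForm (D_WᴴD_W) κ (φ∘fst) z = nsq(D_W z) − Σ_b 2·(cosh κ(φ(tgt b) − φ(src b)) − 1)·
  Re⟨cpx W_b·z_{tgt b}, z_{src b}⟩` — EXACT, for ANY real `W`.
* §3 the SITEWISE bound for isometric `W` (`W_bᵀW_b = 1`): **`localLower_covGram`** — `Re z*(D_WᴴD_W)z − Σ_p J(p.1)·‖z_p‖² ≤
  Re conjForm (D_WᴴD_W) κ (φ∘fst) z` with `J x = Σ_{b : tgt b = x}(cosh κΔφ_b − 1) + Σ_{b : src b = x}(cosh κΔφ_b − 1)`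
  (`bondDefect`, `siteDefect`); the mass term is free (`localLower_smul_one`), so **`localLower_covLap`**: `covLap μ src tgt W`
  costs the same `J` sitewise.
* §4 SCALE-ADAPTED: bond steps `|φ(tgt b) − φ(src b)| ≤ ℓ_b`, `κℓ_b ≤ 1` ⟹ `cosh − 1 ≤ (κℓ_b)²` (file 2's
  `ctWeight_le_sq_of_abs_sub_le` BY NAME) ⟹ `siteDefect ≤ κ²·(Σ_{b ∋ x} ℓ_b²)` (`siteDefect_le_of_bond_scale`); and the END
  **`norm_inv_apply_le_covLap_add`**: for `A = covLap μ src tgt W + P`, `P` any kernel costing `J′` sitewise, `A`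
  locally coercive with profile `λ > 0` (`P` any kernel with a sitewise budget `J′`), weights `d(·,j)` read through the site with bond steps `ℓ_b(j)` (`κℓ ≤ 1`) and
  `κ²Σ_{b∋x}ℓ_b(j)² + J′_{(x,i)} ≤ λ_{(x,i)}/2` ⟹ `‖A⁻¹(p,q)‖ ≤ 2e^{−κd(p,q)}/√(λ_pλ_q)` — file 1's `norm_inv_apply_le_local`
  BY NAME.  For the multi-region operator: `λ = κ₀/n(x)²` from the co-owner's `MultiscaleCoercive`, `ℓ_b = δ/n` on the
  bonds of a side-`n` cell ⟹ `κ²·2ν·δ²/n²` on the SAME scale — the condition `4νκ²δ² ≤ κ₀` sees neither the number of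
  levels nor the volume ([Balaban1985BackgroundPropagators] Thm 3.1 (3.42) p. 397, locator only:
  (3.42)'s local-prefactor shape at the ENTRY ∕ ℓ²-pairing level ONLY — print's (3.42) is a sup-norm operator bound with ONE prefactor `(L^jη)²` at the target and the source in sup norm over a cube `Δ(y′)`, and the entry → sup transfer is NOT level-free; the level-free statement for such consumers is the ℓ²-pairing bound `combesThomas_local`, the local `ℓ² → ℓ^∞` step being O.2 item (ii) (v1.0.1 DOCFIX, d4-p3 XREAD C-d4p3-28 INFO-1)).

ABSOLUTE RULE.  Nothing printed is cited as a fact; no manuscript statement enters as a hypothesis; (3.24) ∕ (3.42) are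
LOCATORS.  Nothing of Bałaban's operators is instantiated; no weight, metric or cell geometry is constructed (instance data,
MODEL lane).  Declarations of files 1–2, of the lineage's `CoarseCoerciveCovariantEnergy`∕`…Laplacian`, of
`AccretiveCombesThomas`, of r1's `DeltaACombesThomas` (`ctWeight`) and of b05's `B5Prop11Lower` are used BY NAME, never
restated.  Row D4: abstract engine, file 3; class of (T3) ∕ NODE O.2 UNCHANGED (critical-path width 0); D4 DISCHARGE NO
DATE; NOT BetaPertH, NOT continuum, NOT Clay, NOT summit progress.
-/

open scoped BigOperators Matrix ComplexConjugate
open Finset Complex Matrix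

namespace Summit.QuantumFields.BalabanUV.Beta.MultiscaleCombesThomasCovariant

open Summit.QuantumFields.BalabanUV.Beta.AccretiveCombesThomas
open Summit.QuantumFields.BalabanUV.Beta.MultiscaleCombesThomas
open Summit.QuantumFields.BalabanUV.Beta.MultiscaleCombesThomasBudget
open Summit.QuantumFields.BalabanUV.Beta.CoarseCoerciveCovariantEnergy (l2 l2_sq l2_nonneg cpx cpx_apply slice
  nsq_eq_sum_slice covDiff slice_covDiff_mulVec nsq_mulVec_cpx l2_mulVec_cpx)
open Summit.QuantumFields.BalabanUV.Beta.CoarseCoerciveCovariantLaplacian (covLap form_covLap re_form_covLap)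
open Literature.MathematicalPhysics.QuantumFieldTheory.Balaban1983to89.B5Prop11Lower (nsq nsq_nonneg
  norm_star_dotProduct_le)
open Literature.MathematicalPhysics.QuantumFieldTheory.Balaban1983to89.Beta.DeltaACombesThomas (ctWeight ctWeight_nonneg)

noncomputable section

/-! ## §1 The conjugated form as a weighted pairing; Gram kernels -/

section Pair

variable {ι α : Type*} [Fintype ι] [Fintype α]

/-- The weighted vector `(e^{κρ}z)_e = e^{κρ_e}·z_e`. [folklore] -/
def wt (κ : ℝ) (ρ : ι → ℝ) (z : ι → ℂ) : ι → ℂ := fun e => ((Real.exp (κ * ρ e) : ℝ) : ℂ) * z e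

omit [Fintype ι] in
/-- Entries of the weighted vector. [folklore] -/
theorem wt_apply (κ : ℝ) (ρ : ι → ℝ) (z : ι → ℂ) (e : ι) : wt κ ρ z e = ((Real.exp (κ * ρ e) : ℝ) : ℂ) * z e := rfl

/-- **The conjugated form is the weighted pairing** `conjForm A κ ρ z = ⟨e^{κρ}z, A(e^{−κρ}z)⟩`. [folklore] -/
theorem conjForm_eq_pair (A : Matrix ι ι ℂ) (κ : ℝ) (ρ : ι → ℝ) (z : ι → ℂ) :
    conjForm A κ ρ z = star (wt κ ρ z) ⬝ᵥ (A *ᵥ wt (-κ) ρ z) := by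
  simp only [conjForm, dotProduct, Matrix.mulVec, Pi.star_apply, wt_apply, Complex.star_def, map_mul,
    Complex.conj_ofReal, Finset.mul_sum]
  refine Finset.sum_congr rfl fun e _ => Finset.sum_congr rfl fun e' _ => ?_
  rw [show κ * (ρ e - ρ e') = κ * ρ e + (-κ) * ρ e' by ring, Real.exp_add]
  push_cast
  ring

/-- **Gram kernels**: `conjForm (DᴴD) κ ρ z = ⟨D(e^{κρ}z), D(e^{−κρ}z)⟩` for any rectangular `D`. [folklore] -/
theorem conjForm_gram (D : Matrix α ι ℂ) (κ : ℝ) (ρ : ι → ℝ) (z : ι → ℂ) :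
    conjForm (Dᴴ * D) κ ρ z = star (D *ᵥ wt κ ρ z) ⬝ᵥ (D *ᵥ wt (-κ) ρ z) := by
  rw [conjForm_eq_pair, ← Matrix.mulVec_mulVec, Matrix.dotProduct_mulVec, ← Matrix.star_mulVec]

end Pair

/-! ## §2 The covariant Laplacian, bond by bond -/

section Covariant

variable {S Cp ι : Type*} [Fintype S] [Fintype Cp] [Fintype ι] [DecidableEq S] [DecidableEq Cp]

omit [Fintype S] [Fintype Cp] [Fintype ι] [DecidableEq S] [DecidableEq Cp] in
/-- Slices of a site-weighted field: `(e^{κφ∘fst}z)(x,·) = e^{κφ x}·z(x,·)`. [folklore] -/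
theorem slice_wt (κ : ℝ) (φ : S → ℝ) (z : S × Cp → ℂ) (x : S) :
    slice (wt κ (fun p : S × Cp => φ p.1) z) x = ((Real.exp (κ * φ x) : ℝ) : ℂ) • slice z x := by
  ext i; rfl

omit [Fintype ι] in
/-- The weighted bond slices: `(D_W(e^{±κφ}z))(b,·) = e^{±κφ(tgt b)}·W_b z_{tgt b} − e^{±κφ(src b)}·z_{src b}`. [folklore] -/
theorem slice_covDiff_wt (src tgt : ι → S) (W : ι → Matrix Cp Cp ℝ) (κ : ℝ) (φ : S → ℝ) (z : S × Cp → ℂ) (b : ι) :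
    slice (covDiff src tgt W *ᵥ wt κ (fun p : S × Cp => φ p.1) z) b =
      ((Real.exp (κ * φ (tgt b)) : ℝ) : ℂ) • (cpx (W b) *ᵥ slice z (tgt b)) -
        ((Real.exp (κ * φ (src b)) : ℝ) : ℂ) • slice z (src b) := by
  rw [slice_covDiff_mulVec, slice_wt, slice_wt, Matrix.mulVec_smul]

omit [DecidableEq Cp] in
/-- The fibre pairing `⟨a•u − b•v, a′•u − b′•v⟩` expanded (real scalars). [folklore] -/
theorem pair_expand (u v : Cp → ℂ) (a b a' b' : ℝ) :
    star (((a : ℝ) : ℂ) • u - ((b : ℝ) : ℂ) • v) ⬝ᵥ ((((a' : ℝ) : ℂ)) • u - ((b' : ℝ) : ℂ) • v) =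
      ((a * a' : ℝ) : ℂ) * (star u ⬝ᵥ u) + ((b * b' : ℝ) : ℂ) * (star v ⬝ᵥ v)
        - ((a * b' : ℝ) : ℂ) * (star u ⬝ᵥ v) - ((b * a' : ℝ) : ℂ) * (star v ⬝ᵥ u) := by
  simp only [dotProduct, Pi.star_apply, Pi.sub_apply, Pi.smul_apply, smul_eq_mul, star_sub, star_mul',
    Complex.star_def, Complex.conj_ofReal, Finset.mul_sum, ← Finset.sum_add_distrib, ← Finset.sum_sub_distrib]
  refine Finset.sum_congr rfl fun i _ => ?_
  push_cast
  ring

omit [DecidableEq Cp] in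
/-- `Re⟨v, u⟩ = Re⟨u, v⟩`. [folklore] -/
theorem re_star_dotProduct_comm (u v : Cp → ℂ) : (star v ⬝ᵥ u).re = (star u ⬝ᵥ v).re := by
  have h : star v ⬝ᵥ u = (starRingEnd ℂ) (star u ⬝ᵥ v) := by
    simp only [dotProduct, map_sum, Pi.star_apply, Complex.star_def, map_mul, Complex.conj_conj]
    exact Finset.sum_congr rfl fun i _ => by ring
  rw [h, Complex.conj_re]

omit [DecidableEq Cp] in
/-- **The per-bond identity** (real part): with `u = W z_t`, `v = z_s`, `τ_t, τ_s` the two weights,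
`Re⟨e^{τ_t}u − e^{τ_s}v, e^{−τ_t}u − e^{−τ_s}v⟩ = Re⟨u − v, u − v⟩ − 2(cosh(τ_t − τ_s) − 1)·Re⟨u, v⟩`. [folklore] -/
theorem re_pair_bond (u v : Cp → ℂ) (τt τs : ℝ) :
    (star (((Real.exp τt : ℝ) : ℂ) • u - ((Real.exp τs : ℝ) : ℂ) • v) ⬝ᵥ
        ((((Real.exp (-τt) : ℝ) : ℂ)) • u - ((Real.exp (-τs) : ℝ) : ℂ) • v)).re =
      (star (u - v) ⬝ᵥ (u - v)).re - 2 * (Real.cosh (τt - τs) - 1) * (star u ⬝ᵥ v).re := by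
  have h1 := pair_expand u v (Real.exp τt) (Real.exp τs) (Real.exp (-τt)) (Real.exp (-τs))
  have h0 : star (u - v) ⬝ᵥ (u - v) = star (((1 : ℝ) : ℂ) • u - ((1 : ℝ) : ℂ) • v) ⬝ᵥ
      ((((1 : ℝ) : ℂ)) • u - ((1 : ℝ) : ℂ) • v) := by simp
  rw [h1, h0, pair_expand]
  have e1 : Real.exp τt * Real.exp (-τt) = 1 := by rw [← Real.exp_add, add_neg_cancel, Real.exp_zero]
  have e2 : Real.exp τs * Real.exp (-τs) = 1 := by rw [← Real.exp_add, add_neg_cancel, Real.exp_zero]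
  have e3 : Real.exp τt * Real.exp (-τs) = Real.exp (τt - τs) := by rw [← Real.exp_add]; ring_nf
  have e4 : Real.exp τs * Real.exp (-τt) = Real.exp (-(τt - τs)) := by rw [← Real.exp_add]; ring_nf
  rw [e1, e2, e3, e4, Real.cosh_eq]
  simp only [Complex.sub_re, Complex.add_re, Complex.mul_re, Complex.ofReal_re, Complex.ofReal_im, zero_mul,
    sub_zero, one_mul, mul_one, re_star_dotProduct_comm v u]
  ring

/-- THE BOND DEFECT WEIGHT `cosh κ(φ(tgt b) − φ(src b)) − 1 ≥ 0` (= `ctWeight κ φ (tgt b) (src b)`). [folklore] -/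
def bondDefect (src tgt : ι → S) (κ : ℝ) (φ : S → ℝ) (b : ι) : ℝ := ctWeight κ φ (tgt b) (src b)

omit [Fintype S] [Fintype ι] [DecidableEq S] in
/-- `bondDefect ≥ 0`. [folklore] -/
theorem bondDefect_nonneg (src tgt : ι → S) (κ : ℝ) (φ : S → ℝ) (b : ι) : 0 ≤ bondDefect src tgt κ φ b :=
  ctWeight_nonneg κ φ (tgt b) (src b)

/-- **THE EXACT IDENTITY for the covariant Laplacian's conjugated form** (any real `W`):
`Re conjForm (D_WᴴD_W) κ (φ∘fst) z = nsq(D_W z) − Σ_b 2·bondDefect_b·Re⟨cpx W_b·z_{tgt b}, z_{src b}⟩`. [folklore] -/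
theorem re_conjForm_covGram (src tgt : ι → S) (W : ι → Matrix Cp Cp ℝ) (κ : ℝ) (φ : S → ℝ) (z : S × Cp → ℂ) :
    (conjForm ((covDiff src tgt W)ᴴ * covDiff src tgt W) κ (fun p : S × Cp => φ p.1) z).re =
      nsq (covDiff src tgt W *ᵥ z) -
        ∑ b, 2 * bondDefect src tgt κ φ b *
          (star (cpx (W b) *ᵥ slice z (tgt b)) ⬝ᵥ slice z (src b)).re := by
  rw [conjForm_gram]
  -- split the pairing over the bonds
  have hsplit : ∀ (f g : ι × Cp → ℂ), star f ⬝ᵥ g = ∑ b, star (slice f b) ⬝ᵥ slice g b := by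
    intro f g
    rw [dotProduct, Fintype.sum_prod_type]
    rfl
  rw [hsplit, Complex.re_sum, nsq_eq_sum_slice, ← Finset.sum_sub_distrib]
  refine Finset.sum_congr rfl fun b _ => ?_
  rw [slice_covDiff_wt, slice_covDiff_wt, show -κ * φ (tgt b) = -(κ * φ (tgt b)) by ring,
    show -κ * φ (src b) = -(κ * φ (src b)) by ring, re_pair_bond, slice_covDiff_mulVec, bondDefect, ctWeight,
    show κ * φ (tgt b) - κ * φ (src b) = κ * (φ (tgt b) - φ (src b)) by ring]
  congr 1
  rw [Literature.MathematicalPhysics.QuantumFieldTheory.Balaban1983to89.B5Prop11Lower.star_dotProduct_self,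
    Complex.ofReal_re]

/-! ## §3 The sitewise bound for isometric transporters -/

/-- THE SITE DEFECT: `J x = Σ_{b : tgt b = x} bondDefect_b + Σ_{b : src b = x} bondDefect_b` — the cosh weights of the bonds
AT `x`, nothing else (no fibre dimension, no `sup`). [folklore] -/
def siteDefect (src tgt : ι → S) (κ : ℝ) (φ : S → ℝ) (x : S) : ℝ :=
  ∑ b, ((if tgt b = x then bondDefect src tgt κ φ b else 0) + (if src b = x then bondDefect src tgt κ φ b else 0))

omit [Fintype S] [DecidableEq Cp] in
/-- `siteDefect ≥ 0`. [folklore] -/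
theorem siteDefect_nonneg (src tgt : ι → S) (κ : ℝ) (φ : S → ℝ) (x : S) : 0 ≤ siteDefect src tgt κ φ x := by
  refine Finset.sum_nonneg fun b _ => add_nonneg ?_ ?_ <;> split_ifs <;>
    first | exact bondDefect_nonneg src tgt κ φ b | exact le_rfl

omit [DecidableEq Cp] in
/-- Bookkeeping: `Σ_b w_b·(nsq z_{tgt b} + nsq z_{src b}) = Σ_p J(p.1)·‖z_p‖²`. [folklore] -/
theorem sum_bond_mass_eq (src tgt : ι → S) (κ : ℝ) (φ : S → ℝ) (z : S × Cp → ℂ) :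
    ∑ b, bondDefect src tgt κ φ b * (nsq (slice z (tgt b)) + nsq (slice z (src b))) =
      ∑ p : S × Cp, siteDefect src tgt κ φ p.1 * ‖z p‖ ^ 2 := by
  have hslice : ∀ x, nsq (slice z x) = ∑ i, ‖z (x, i)‖ ^ 2 := fun x => rfl
  rw [Fintype.sum_prod_type]
  simp_rw [← Finset.mul_sum, ← hslice]
  simp only [siteDefect, Finset.sum_mul, add_mul, Finset.sum_add_distrib, ite_mul, zero_mul]
  rw [Finset.sum_comm (f := fun x b => if tgt b = x then _ else _),
    Finset.sum_comm (f := fun x b => if src b = x then _ else _)]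
  simp only [Finset.sum_ite_eq, Finset.mem_univ, if_true, mul_add, Finset.sum_add_distrib]

/-- **THE SITEWISE BOUND**: for isometric transporters (`W_bᵀW_b = 1`) the covariant Laplacian `D_WᴴD_W` costs, at weight
`(κ, φ∘fst)`, at most `siteDefect x` at every site of the fibre over `x` — `Re z*(D_WᴴD_W)z − Σ_p J(p.1)‖z_p‖² ≤
Re conjForm (D_WᴴD_W) κ (φ∘fst) z` — the hypothesis shape «costs at most `J` sitewise» of `MultiscaleCombesThomasBudget`.
[folklore] -/
theorem localLower_covGram (src tgt : ι → S) (W : ι → Matrix Cp Cp ℝ) (hW : ∀ b, (W b)ᵀ * W b = 1) (κ : ℝ)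
    (φ : S → ℝ) (z : S × Cp → ℂ) :
    (star z ⬝ᵥ (((covDiff src tgt W)ᴴ * covDiff src tgt W) *ᵥ z)).re -
        ∑ p : S × Cp, siteDefect src tgt κ φ p.1 * ‖z p‖ ^ 2 ≤
      (conjForm ((covDiff src tgt W)ᴴ * covDiff src tgt W) κ (fun p : S × Cp => φ p.1) z).re := by
  have hform : (star z ⬝ᵥ (((covDiff src tgt W)ᴴ * covDiff src tgt W) *ᵥ z)).re = nsq (covDiff src tgt W *ᵥ z) := by
    rw [← Matrix.mulVec_mulVec, Matrix.dotProduct_mulVec, ← Matrix.star_mulVec,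
      Literature.MathematicalPhysics.QuantumFieldTheory.Balaban1983to89.B5Prop11Lower.star_dotProduct_self,
      Complex.ofReal_re]
  rw [hform, re_conjForm_covGram, ← sum_bond_mass_eq]
  -- per bond: 2·w·Re⟨W z_t, z_s⟩ ≤ w·(nsq z_t + nsq z_s)
  have hb : ∀ b, 2 * bondDefect src tgt κ φ b * (star (cpx (W b) *ᵥ slice z (tgt b)) ⬝ᵥ slice z (src b)).re ≤
      bondDefect src tgt κ φ b * (nsq (slice z (tgt b)) + nsq (slice z (src b))) := by
    intro b
    have hw := bondDefect_nonneg src tgt κ φ b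
    have hcs : (star (cpx (W b) *ᵥ slice z (tgt b)) ⬝ᵥ slice z (src b)).re ≤
        Real.sqrt (nsq (slice z (tgt b))) * Real.sqrt (nsq (slice z (src b))) := by
      refine (Complex.re_le_norm _).trans ((norm_star_dotProduct_le _ _).trans_eq ?_)
      rw [nsq_mulVec_cpx (W b) (hW b)]
    have hamgm : Real.sqrt (nsq (slice z (tgt b))) * Real.sqrt (nsq (slice z (src b))) ≤
        (nsq (slice z (tgt b)) + nsq (slice z (src b))) / 2 := by
      nlinarith [sq_nonneg (Real.sqrt (nsq (slice z (tgt b))) - Real.sqrt (nsq (slice z (src b)))),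
        Real.sq_sqrt (nsq_nonneg (slice z (tgt b))), Real.sq_sqrt (nsq_nonneg (slice z (src b)))]
    nlinarith
  linarith [Finset.sum_le_sum fun b (_ : b ∈ Finset.univ) => hb b]

/-- A real multiple of the identity costs NOTHING sitewise (its conjugated form is its form). [folklore] -/
theorem localLower_smul_one {Y : Type*} [Fintype Y] [DecidableEq Y] (μ0 κ : ℝ) (ρ : Y → ℝ) (z : Y → ℂ) :
    (star z ⬝ᵥ ((((μ0 : ℝ) : ℂ) • (1 : Matrix Y Y ℂ)) *ᵥ z)).re - ∑ e, (0 : ℝ) * ‖z e‖ ^ 2 ≤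
      (conjForm (((μ0 : ℝ) : ℂ) • (1 : Matrix Y Y ℂ)) κ ρ z).re := by
  simp only [zero_mul, Finset.sum_const_zero, sub_zero]
  refine le_of_eq ?_
  rw [conjForm, star_dotProduct_mulVec_eq]
  congr 1
  refine Finset.sum_congr rfl fun e _ => Finset.sum_congr rfl fun e' _ => ?_
  by_cases h : e = e'
  · subst h; simp
  · simp [Matrix.one_apply_ne h]

/-- **THE COVARIANT LAPLACIAN WITH MASS costs `siteDefect` sitewise** (`covLap μ src tgt W = μ·1 + D_WᴴD_W`, isometric `W`).
[folklore] -/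
theorem localLower_covLap (μ0 : ℝ) (src tgt : ι → S) (W : ι → Matrix Cp Cp ℝ) (hW : ∀ b, (W b)ᵀ * W b = 1)
    (κ : ℝ) (φ : S → ℝ) (z : S × Cp → ℂ) :
    (star z ⬝ᵥ (covLap μ0 src tgt W *ᵥ z)).re - ∑ p : S × Cp, siteDefect src tgt κ φ p.1 * ‖z p‖ ^ 2 ≤
      (conjForm (covLap μ0 src tgt W) κ (fun p : S × Cp => φ p.1) z).re := by
  have h := localLower_add (localLower_smul_one (Y := S × Cp) μ0 κ (fun p : S × Cp => φ p.1))
    (localLower_covGram src tgt W hW κ φ) z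
  simp only [zero_add] at h
  exact h

/-! ## §4 Scale-adapted bond steps and the END for `covLap + P` -/

omit [Fintype S] [Fintype ι] [DecidableEq S] [DecidableEq Cp] in
/-- Bond steps: `|φ(tgt b) − φ(src b)| ≤ ℓ_b`, `0 ≤ κ`, `κℓ_b ≤ 1` ⟹ `bondDefect_b ≤ (κℓ_b)²` (second order; file 2's
`ctWeight_le_sq_of_abs_sub_le` BY NAME). [folklore] -/
theorem bondDefect_le_sq (src tgt : ι → S) {κ : ℝ} (hκ : 0 ≤ κ) (φ : S → ℝ) (ℓ : ι → ℝ)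
    (hφ : ∀ b, |φ (tgt b) - φ (src b)| ≤ ℓ b) (h1 : ∀ b, κ * ℓ b ≤ 1) (b : ι) :
    bondDefect src tgt κ φ b ≤ (κ * ℓ b) ^ 2 :=
  ctWeight_le_sq_of_abs_sub_le hκ (hφ b) (h1 b)

omit [Fintype S] [DecidableEq Cp] in
/-- **Sitewise defect from bond scales**: `siteDefect x ≤ κ²·Σ_b ([tgt b = x] + [src b = x])·ℓ_b²`. [folklore] -/
theorem siteDefect_le_of_bond_scale (src tgt : ι → S) {κ : ℝ} (hκ : 0 ≤ κ) (φ : S → ℝ) (ℓ : ι → ℝ)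
    (hφ : ∀ b, |φ (tgt b) - φ (src b)| ≤ ℓ b) (h1 : ∀ b, κ * ℓ b ≤ 1) (x : S) :
    siteDefect src tgt κ φ x ≤
      κ ^ 2 * ∑ b, ((if tgt b = x then ℓ b ^ 2 else 0) + (if src b = x then ℓ b ^ 2 else 0)) := by
  rw [siteDefect, Finset.mul_sum]
  refine Finset.sum_le_sum fun b _ => ?_
  have hb := bondDefect_le_sq src tgt hκ φ ℓ hφ h1 b
  rw [mul_add]
  refine add_le_add ?_ ?_ <;> split_ifs <;> nlinarith [hb]

/-- **THE END FOR `A = covLap μ W + P`** (isometric `W`; `P` ANY kernel costing `J′` sitewise at the weights below — e.g. the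
averaging terms; `A` locally coercive with profile `λ > 0`): weights `d(·, j)` READ THROUGH THE SITE (`d((x,i), j) = φ_j(x)`) with bond steps
`|φ_j(tgt b) − φ_j(src b)| ≤ ℓ_b(j)`, `κℓ_b(j) ≤ 1`, and the sitewise budget
`κ²·Σ_{b∋x}ℓ_b(j)² + J′_j(x,i) ≤ λ_{(x,i)}/2` ⟹ `‖A⁻¹(p,q)‖ ≤ 2e^{−κ d(p,q)}/√(λ_pλ_q)` — file 1's `norm_inv_apply_le_local`
BY NAME with profile `λ/2`. [cite: Balaban1985BackgroundPropagators, Thm 3.1 (3.42) p.397] [folklore] -/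
theorem norm_inv_apply_le_covLap_add (μ0 : ℝ) (src tgt : ι → S) (W : ι → Matrix Cp Cp ℝ) (hW : ∀ b, (W b)ᵀ * W b = 1)
    (P : Matrix (S × Cp) (S × Cp) ℂ) {κ : ℝ} (hκ : 0 ≤ κ) (φ : S × Cp → S → ℝ) (hφ0 : ∀ q, φ q q.1 = 0) (ℓ : S × Cp → ι → ℝ)
    (hφ : ∀ q b, |φ q (tgt b) - φ q (src b)| ≤ ℓ q b) (h1 : ∀ q b, κ * ℓ q b ≤ 1)
    (J' : S × Cp → S × Cp → ℝ)
    (hJ' : ∀ q (z : S × Cp → ℂ), (star z ⬝ᵥ (P *ᵥ z)).re - ∑ p, J' q p * ‖z p‖ ^ 2 ≤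
      (conjForm P κ (fun p : S × Cp => φ q p.1) z).re)
    (lam : S × Cp → ℝ) (hlam : ∀ p, 0 < lam p)
    (hA : ∀ z : S × Cp → ℂ, ∑ p, lam p * ‖z p‖ ^ 2 ≤ (star z ⬝ᵥ ((covLap μ0 src tgt W + P) *ᵥ z)).re)
    (hsmall : ∀ q p, κ ^ 2 * ∑ b, ((if tgt b = p.1 then ℓ q b ^ 2 else 0) + (if src b = p.1 then ℓ q b ^ 2 else 0))
      + J' q p ≤ lam p / 2)
    (p q : S × Cp) :
    ‖(covLap μ0 src tgt W + P)⁻¹ p q‖ ≤ 2 * Real.exp (-(κ * φ q p.1)) / Real.sqrt (lam p * lam q) := by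
  have hμ : ∀ e, 0 < lam e / 2 := fun e => half_pos (hlam e)
  -- local conjugated coercivity with profile λ/2 along every column weight
  have hc : ∀ q, ∀ z : S × Cp → ℂ,
      ∑ e, lam e / 2 * ‖z e‖ ^ 2 ≤ (conjForm (covLap μ0 src tgt W + P) κ (fun e => φ q e.1) z).re := by
    intro q z
    have hloc := localConjCoercive_of_localLower hA
      (fun w => localLower_add (fun w' => localLower_mono (localLower_covLap μ0 src tgt W hW κ (φ q))
        (fun e => siteDefect_le_of_bond_scale src tgt hκ (φ q) (ℓ q) (hφ q) (h1 q) e.1) w') (hJ' q) w) z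
    refine le_trans (Finset.sum_le_sum fun e _ => ?_) hloc
    exact mul_le_mul_of_nonneg_right (by linarith [hsmall q e]) (sq_nonneg _)
  have h := norm_inv_apply_le_local (covLap μ0 src tgt W + P) (fun p q => φ q p.1) (fun q => hφ0 q) hκ hμ hc p q
  have hsqrt : Real.sqrt (lam p / 2 * (lam q / 2)) = Real.sqrt (lam p * lam q) / 2 := by
    rw [show lam p / 2 * (lam q / 2) = lam p * lam q / (2 * 2) by ring, Real.sqrt_div' _ (by norm_num : (0:ℝ) ≤ 2 * 2),
      Real.sqrt_mul_self zero_le_two]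
  rw [hsqrt, div_div_eq_mul_div] at h
  calc ‖(covLap μ0 src tgt W + P)⁻¹ p q‖ ≤ Real.exp (-(κ * φ q p.1)) * 2 / Real.sqrt (lam p * lam q) := h
    _ = 2 * Real.exp (-(κ * φ q p.1)) / Real.sqrt (lam p * lam q) := by ring

end Covariant

end

end Summit.QuantumFields.BalabanUV.Beta.MultiscaleCombesThomasCovariant
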